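/-
Origin: expansion seat `planner-pub-hodgecm-pv04-g6-0`, handover #3 2026-08-18T09:31:06Z (`HOME/pub-hodgecm-pv04-g6/lean/Pv04g6/CMInflationIndependentLedger.lean`, md5 bf696bd7, 124 lines);
landed by the gen-7 packager in gate run 27 as `HodgeCM/Model/Toy/CMInflationIndependentLedger.lean` (import ^import Pv04g6\.CMInflationIndependent\b→import HodgeCM.Model.Toy.CMInflationIndependent ×1).
-/
/-
Copyright: pub-hodgecm cell (HodgeCMPerL). Consistency-witness layer (part (e)); FACTS.md §1c row (M38), column P5.
Origin: HOME/pub-hodgecm-pv04-g6/lean/Pv04g6/CMInflationIndependentLedger.lean (WIP module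
`Pv04g6.CMInflationIndependentLedger`; intended final place `HodgeCM/Model/Toy/CMInflationIndependentLedger.lean` =
module `HodgeCM.Model.Toy.CMInflationIndependentLedger`, CONTRIBUTING §3 kind L5) (seat planner-pub-hodgecm-pv04-g6-0,
DAG-node prover #04 gen 6, seam S6 / fact row M38).
WIP import to rewrite on landing: `import Pv04g6.CMInflationIndependent` ↦ `import HodgeCM.Model.Toy.CMInflationIndependent`.
-/
import Summits.HodgeConjecture.HodgeCM.Model.Toy.CMInflationIndependent
import Summits.HodgeConjecture.HodgeCM.Model.Toy.ToyFFacts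
import Summits.HodgeConjecture.HodgeCM.Model.Toy.ToyTrTop
import Summits.HodgeConjecture.HodgeCM.Model.Toy.H0Rank

/-!
# M38 is independent of `ModelAxioms` together with the morphism-free ledger facts

Strengthening of `HodgeCM.Toy.cmInflation_independent` (`CMInflationIndependent.lean`): the tagged toy universe
`tagModel exteriorHodgeData` — `ModelAxioms`, `¬ Fact_cmInflation` — ALSO satisfies every kernel-witnessed candidate
fact of `HOME/FACTS.md` §1c that the exterior toy satisfies and that does not assert anything about morphisms
between products: N1 `Fact_cupExterior`, N2 `Fact_cup_hodge`, N3 `Fact_pull_H0`, N4 `Fact_hodge_F0`,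
F4 `Fact_cupAlg`, F5 `Fact_cupAssoc`, D (M40) `Fact_dimProd`, and `Fact_H0_rank`.  Hence M38 is independent of
M1–M28 ∧ N1–N4 ∧ F4 ∧ F5 ∧ D ∧ `Fact_H0_rank` jointly (`cmInflation_independent_ledger`).

Generic part (`HodgeCM.Universe.restrict_*`): these facts transfer from `U` to any morphism restriction
`U.restrict C` — verbatim (same cohomology, cup product, Hodge data, algebraic classes, dimension), through
`restrict_cmProd : (U.restrict C).cmProd F Θ = U.cmProd F Θ` and `restrict_cupPow` for N1, and through `f.1` for N3.
(F7 `Fact_gysin` / F7d `Fact_gysinDescent` / F2 quantify over block projections of products and are not treated here.)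
-/

noncomputable section

namespace HodgeCM

namespace Universe

variable (U : Universe) (C : U.MorClass)

/-- (Ported verbatim from the HodgeCMPerL package; no docstring in the source.) -/
theorem restrict_prodFin (n : ℕ) (X : Fin (n + 1) → U.Var) : (U.restrict C).prodFin n X = U.prodFin n X := by
  induction n with
  | zero => rfl
  | succ n ih =>
    rw [prodFin, prodFin, ih]

/-- (Ported verbatim from the HodgeCMPerL package; no docstring in the source.) -/
theorem restrict_cmProd (F : CMField) {n : ℕ} (Θ : Fin (n + 1) → Literature.AlgebraicGeometry.Motives.CMType F) :
    (U.restrict C).cmProd F Θ = U.cmProd F Θ :=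
  U.restrict_prodFin C n _

/-- The iterated cup product does not see the morphisms. -/
theorem restrict_cupPow (X : U.Var) (k : ℕ) : (U.restrict C).cupPow X k = U.cupPow X k := by
  induction k with
  | zero => rfl
  | succ k ih =>
    funext a
    rw [cupPow_succ, cupPow_succ, ih]

/-- (Ported verbatim from the HodgeCMPerL package; no docstring in the source.) -/
theorem restrict_cupExterior_iff (X : U.Var) (k : ℕ) : (U.restrict C).CupExterior X k ↔ U.CupExterior X k := by
  unfold CupExterior
  rw [restrict_cupPow]

/-- N1 transfers to a morphism restriction. -/
theorem restrict_fact_cupExterior (h : U.Fact_cupExterior) : (U.restrict C).Fact_cupExterior := by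
  intro F n Θ k
  rw [restrict_cmProd, restrict_cupExterior_iff]
  exact h F n Θ k

/-- N2 transfers. -/
theorem restrict_fact_cup_hodge (h : U.Fact_cup_hodge) : (U.restrict C).Fact_cup_hodge := h

/-- N3 transfers. -/
theorem restrict_fact_pull_H0 (h : U.Fact_pull_H0) : (U.restrict C).Fact_pull_H0 := fun X f => h X f.1

/-- N4 transfers. -/
theorem restrict_fact_hodge_F0 (h : U.Fact_hodge_F0) : (U.restrict C).Fact_hodge_F0 := h

/-- F4 transfers. -/
theorem restrict_fact_cupAlg (h : U.Fact_cupAlg) : (U.restrict C).Fact_cupAlg := h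

/-- F5 transfers. -/
theorem restrict_fact_cupAssoc (h : U.Fact_cupAssoc) : (U.restrict C).Fact_cupAssoc := h

/-- D (M40) transfers. -/
theorem restrict_fact_dimProd (h : U.Fact_dimProd) : (U.restrict C).Fact_dimProd := h

/-- `Fact_H0_rank` transfers. -/
theorem restrict_fact_H0_rank (h : U.Fact_H0_rank) : (U.restrict C).Fact_H0_rank := h

end Universe

namespace Toy

open CMInflationIndependent

/-- The tagged exterior toy universe satisfies `ModelAxioms` and the eight morphism-free ledger facts
N1–N4, F4, F5, D, `Fact_H0_rank`. -/
theorem tagModel_ledger :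
    (tagModel exteriorHodgeData).ModelAxioms ∧ (tagModel exteriorHodgeData).Fact_cupExterior ∧
      (tagModel exteriorHodgeData).Fact_cup_hodge ∧ (tagModel exteriorHodgeData).Fact_pull_H0 ∧
      (tagModel exteriorHodgeData).Fact_hodge_F0 ∧ (tagModel exteriorHodgeData).Fact_cupAlg ∧
      (tagModel exteriorHodgeData).Fact_cupAssoc ∧ (tagModel exteriorHodgeData).Fact_dimProd ∧
      (tagModel exteriorHodgeData).Fact_H0_rank :=
  ⟨tagModel_modelAxioms,
    (toyModelWith exteriorHodgeData).restrict_fact_cupExterior _ (fact_cupExterior exteriorHodgeData),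
    (toyModelWith exteriorHodgeData).restrict_fact_cup_hodge _ fact_cup_hodge,
    (toyModelWith exteriorHodgeData).restrict_fact_pull_H0 _ (fact_pull_H0 exteriorHodgeData),
    (toyModelWith exteriorHodgeData).restrict_fact_hodge_F0 _ fact_hodge_F0,
    (toyModelWith exteriorHodgeData).restrict_fact_cupAlg _ fact_cupAlg,
    (toyModelWith exteriorHodgeData).restrict_fact_cupAssoc _ (fact_cupAssoc exteriorHodgeData),
    (toyModelWith exteriorHodgeData).restrict_fact_dimProd _ (fact_dimProd exteriorHodgeData),
    (toyModelWith exteriorHodgeData).restrict_fact_H0_rank _ (fact_H0_rank exteriorHodgeData)⟩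

/-- **M38 is independent of M1–M28 ∧ N1–N4 ∧ F4 ∧ F5 ∧ D ∧ `Fact_H0_rank` (jointly).** -/
theorem cmInflation_independent_ledger :
    ∃ U : Universe, (U.ModelAxioms ∧ U.Fact_cupExterior ∧ U.Fact_cup_hodge ∧ U.Fact_pull_H0 ∧ U.Fact_hodge_F0 ∧
      U.Fact_cupAlg ∧ U.Fact_cupAssoc ∧ U.Fact_dimProd ∧ U.Fact_H0_rank) ∧ ¬ U.Fact_cmInflation :=
  ⟨tagModel exteriorHodgeData, tagModel_ledger, not_fact_cmInflation exteriorHodgeData⟩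

/-! ### Axiom closures of the headline declarations (expected: `propext`, `Classical.choice`, `Quot.sound`):
`HodgeCM.Toy.cmInflation_independent_ledger`, `HodgeCM.Toy.tagModel_ledger`. -/

end Toy

end HodgeCM

end
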